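import Mathlib.NumberTheory.Padics.Complex
import Mathlib.FieldTheory.KrullTopology
import Mathlib.FieldTheory.Galois.Infinite
import Summits.ABC.IUTFork.LanaLocalUnits
import Summits.ABC.IUTFork.LanaLogShell
import HarnessLib

/-!
# L-LANA objects II bis: the reference local data at `K_v = ℚ_p`, CONSTRUCTED (LANA §3.5–3.9 for `G_{ℚ_p} ↷ ℚ̄_p`)

Record-only file (D-0012) of the abc-iut cell (seat abc-iut-c312-4, L-LANA level, LLANA-SPEC N3/N4
instance); TAKES NO SIDE on [IUTchIII] Cor. 3.12. `LanaLocalUnits.lean` builds `O^▷ ⊇ O^× ↠ O^{×μ}` and the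
`×μ`-Kummer structure `{I^κ_H}` from ANY field with a valuation and a valuation-preserving group action,
the preservation being a hypothesis class (`IsValPreserving`) "to be supplied by the Galois interface".
This file SUPPLIES it at a `p`-adic place with `K_v = ℚ_p`, entirely from Mathlib:

* `K̄_v := ℚ̄_p` = `PadicAlgCl p` (Mathlib: `AlgebraicClosure ℚ_[p]` with the spectral norm, `Valued … ℝ≥0`);
* `G_v := Gal(ℚ̄_p/ℚ_p)` = `ℚ̄_p ≃ₐ[ℚ_p] ℚ̄_p` with the Krull topology (a topological group, Mathlib), acting
  on `ℚ̄_p` by `MulSemiringAction` (`AlgEquiv.applyMulSemiringAction`);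
* PROVED: `norm_galois` — "`G_v` … the group of suitable automorphisms of the field `K̄_v`" (§3.5 p. 19)
  acts by ISOMETRIES (uniqueness of the spectral norm, Mathlib `spectralNorm_eq_of_equiv`), whence the
  instance `IsValPreserving`; and `continuousSMul_galois` — the action `G_v × K̄_v → K̄_v` is CONTINUOUS
  (Krull × norm topology; stabilisers are open, Mathlib `stabilizer_isOpen_of_isIntegral`, and `G_v` acts
  isometrically) — the two inputs `RefLocalDatum` (`LanaStrips.lean`) asks of the place.
* Hence, with no hypothesis left: `padicUnitsModTorsion p` = `G_{ℚ_p} ↷ O^{×μ}_{ℚ̄_p}` (§3.6 p. 20),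
  `padicKummer p H = I^κ_H` (Def. 3.9.1 p. 22), `padicLogShellMF p` = the `(MF)` log-shell (§5.1 (c) p. 27)
  — the étale-unit reference datum of a BPS at a `ℚ_p`-place is a Mathlib object.

Modelling notes. (i) `Π_v ↠ G_v` (tempered/étale `π₁` of the curve) is NOT constructed here (seat
abc-iut-L3-t2 / L4-t1); the `RefLocalDatum` packaging with a genuine `Π_v` waits for it. (ii) General `K_v`
(finite extensions of `ℚ_p`) work verbatim with `AlgebraicClosure K_v` once Mathlib's spectral-norm
`NormedField` instance is invoked for them; `ℚ_p` is the case Mathlib packages (`PadicAlgCl`).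
[cite: LANA2026Report, §3.5 p. 19, §3.6 p. 20, Def. 3.9.1 p. 22, §5.1 (c) p. 27] NOT here: any judgement.
-/

noncomputable section

namespace Summit.ABC
namespace IUTFork

open scoped NNReal

variable (p : ℕ) [Fact p.Prime]

/-- `G_v = Gal(ℚ̄_p/ℚ_p)`, the absolute Galois group of `ℚ_p` realised on Mathlib's `ℚ̄_p = PadicAlgCl p`
(Krull topology). [cite: LANA2026Report, §3.5 p. 19] -/
abbrev PadicGal : Type := PadicAlgCl p ≃ₐ[ℚ_[p]] PadicAlgCl p

/-- The valuation `| · |` of `ℚ̄_p` (values in `ℝ≥0`; Mathlib's `Valued` instance = the spectral norm).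
[cite: LANA2026Report, §0.4 (b) p. 8] -/
abbrev padicVal : Valuation (PadicAlgCl p) ℝ≥0 := Valued.v

/-- **`G_v` acts on `K̄_v` by isometries**: `‖σ x‖ = ‖x‖` (the norm of `ℚ̄_p` is the spectral norm, which
every `ℚ_p`-automorphism preserves). [cite: LANA2026Report, §3.5 p. 19] -/
theorem norm_galois (σ : PadicGal p) (x : PadicAlgCl p) : ‖σ x‖ = ‖x‖ := by
  rw [← PadicAlgCl.spectralNorm_eq, ← PadicAlgCl.spectralNorm_eq, ← spectralNorm_eq_of_equiv]

/-- **The hypothesis class of `LanaLocalUnits`, DISCHARGED at `ℚ_p`**: `Gal(ℚ̄_p/ℚ_p)` preserves `| · |`.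
[cite: LANA2026Report, §3.5 p. 19] -/
instance isValPreserving_padic : IsValPreserving (padicVal p) (PadicGal p) where
  val_smul σ x := by
    apply NNReal.coe_injective
    rw [padicVal, PadicAlgCl.valuation_coe, PadicAlgCl.valuation_coe, AlgEquiv.smul_def, norm_galois]

/-- **Continuity of `G_v × K̄_v → K̄_v`** (Krull topology on `G_v`, norm topology on `ℚ̄_p`): stabilisers of
algebraic elements are open and `G_v` acts by isometries. [cite: LANA2026Report, Def. 3.7.1 p. 20] -/
instance continuousSMul_galois : ContinuousSMul (PadicGal p) (PadicAlgCl p) where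
  continuous_smul := by
    rw [continuous_iff_continuousAt]
    rintro ⟨σ₀, x₀⟩
    rw [ContinuousAt, Metric.tendsto_nhds]
    intro ε hε
    have hU : {σ : PadicGal p | σ₀⁻¹ * σ ∈ MulAction.stabilizer (PadicGal p) x₀} ∈ nhds σ₀ := by
      refine IsOpen.mem_nhds ?_ ?_
      · exact (stabilizer_isOpen_of_isIntegral (K := ℚ_[p]) x₀).preimage (continuous_const_mul σ₀⁻¹)
      · simp [MulAction.mem_stabilizer_iff]
    have hV : Metric.ball x₀ ε ∈ nhds x₀ := Metric.ball_mem_nhds x₀ hε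
    filter_upwards [prod_mem_nhds hU hV]
    rintro ⟨σ, x⟩ ⟨hσ, hx⟩
    simp only [Set.mem_setOf_eq, MulAction.mem_stabilizer_iff, AlgEquiv.smul_def] at hσ
    rw [Metric.mem_ball, dist_eq_norm] at hx
    rw [dist_eq_norm, AlgEquiv.smul_def, AlgEquiv.smul_def]
    have h1 : σ x - σ₀ x₀ = σ₀ ((σ₀⁻¹ * σ) (x - x₀)) := by
      rw [map_sub, AlgEquiv.mul_apply, hσ, map_sub, ← AlgEquiv.mul_apply, mul_inv_cancel, AlgEquiv.one_apply]
    rw [h1, norm_galois, norm_galois]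
    exact hx

/-! ## The reference objects at `ℚ_p`, with no hypothesis left -/

/-- `O^×_{ℚ̄_p} ≤ ℚ̄_p^×` with its `Gal(ℚ̄_p/ℚ_p)`-action (§3.6 p. 19). [cite: LANA2026Report, §3.6 p. 19] -/
abbrev padicUnits : Subgroup (PadicAlgCl p)ˣ := unitGrp (padicVal p)

/-- **`G_{ℚ_p} ↷ O^{×μ}_{ℚ̄_p} = O^×/O^μ`**, the coric mono-analytic datum of §3.6 at `K_v = ℚ_p`, CONSTRUCTED; its
`Gal`-action is the instance `UnitsModTorsion.instMulDistribMulAction` (no hypothesis: `isValPreserving_padic`).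
[cite: LANA2026Report, §3.6 p. 20] -/
abbrev padicUnitsModTorsion : Type := UnitsModTorsion (padicVal p)

/-- The `Gal(ℚ̄_p/ℚ_p)`-action on `O^{×μ}_{ℚ̄_p}` is available as an instance. [cite: LANA2026Report, §3.6 p. 20] -/
example : MulDistribMulAction (PadicGal p) (padicUnitsModTorsion p) := inferInstance

/-- **`I^κ_H` at `ℚ_p`** (Def. 3.9.1): the image of the `H`-invariant units of `ℚ̄_p`, for `H ≤ Gal(ℚ̄_p/ℚ_p)`.
[cite: LANA2026Report, Def. 3.9.1 p. 22] -/
abbrev padicKummer (H : Subgroup (PadicGal p)) : Subgroup (padicUnitsModTorsion p) :=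
  kummerStructure (padicVal p) (PadicGal p) H

/-- **The `(MF)` log-shell at `ℚ_p`** (§5.1 (c)): the `2p`-th roots of `I^κ_{G_v}` inside `O^{×μ}_{ℚ̄_p}`.
[cite: LANA2026Report, §5.1 (c) p. 27] -/
abbrev padicLogShellMF : Subgroup (padicUnitsModTorsion p) := logShellMF (padicVal p) (PadicGal p) p

/-- `I^κ_{G_v} ≤ I_v(F^{⊢×μ})` at `ℚ_p`. [cite: LANA2026Report, §5.1 (c) p. 27] -/
theorem padicKummer_top_le_logShell : padicKummer p ⊤ ≤ padicLogShellMF p :=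
  kummer_le_logShellMF (padicVal p) (PadicGal p) p

/-- `p ∈ O^▷_{ℚ̄_p}` and `p ∉ O^×` : `|p| = 1/p < 1` — the value group is genuinely deformed away from the
units (§3.6 "the value groups are not coric"). [cite: LANA2026Report, §3.6 p. 19] -/
theorem p_mem_intMonoid : (p : PadicAlgCl p) ∈ intMonoid (padicVal p) := by
  have hp : (1 : ℝ≥0) < p := by exact_mod_cast (Fact.out : p.Prime).one_lt
  rw [mem_intMonoid_iff, padicVal, PadicAlgCl.valuation_p]
  refine ⟨by positivity, ?_⟩
  rw [one_div]
  exact inv_le_one_of_one_le₀ hp.le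

/-! ## §3.9 at `ℚ_p`: the invariants recover the base -/

/-- `ℚ̄_p/ℚ_p` is Galois (normal: algebraic closure; separable: characteristic `0`). [folklore] -/
instance isGalois_padicAlgCl : IsGalois ℚ_[p] (PadicAlgCl p) := {}

/-- **§3.9 p. 21 at `ℚ_p`** ("the version without an overline is defined by its `G_v`-invariant portion"):
the `Gal(ℚ̄_p/ℚ_p)`-invariants of `K̄_v = ℚ̄_p` are exactly `K_v = ℚ_p` (infinite Galois theory, Mathlib
`InfiniteGalois.mem_range_algebraMap_iff_fixed`). [cite: LANA2026Report, §3.9 p. 21] -/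
theorem fixed_iff_mem_range (x : PadicAlgCl p) :
    (∀ σ : PadicGal p, σ • x = x) ↔ x ∈ Set.range (algebraMap ℚ_[p] (PadicAlgCl p)) := by
  rw [InfiniteGalois.mem_range_algebraMap_iff_fixed]
  simp only [AlgEquiv.smul_def]

/-- **`O^×_v := (O^×_{K̄_v})^{G_v}` at `ℚ_p` IS the group of units of `ℚ_p` of absolute value `1`** (i.e. `ℤ_p^×`,
embedded in `ℚ̄_p`): an element of `O^×_{ℚ̄_p}` is `Gal`-invariant iff it comes from `ℚ_p`.
[cite: LANA2026Report, §3.9 p. 21] -/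
theorem mem_unitInv_iff (u : unitGrp (padicVal p)) :
    u ∈ unitInv (padicVal p) (PadicGal p) ↔
      ((u : (PadicAlgCl p)ˣ) : PadicAlgCl p) ∈ Set.range (algebraMap ℚ_[p] (PadicAlgCl p)) := by
  rw [← fixed_iff_mem_range, unitInv, mem_unitInvariants_iff]
  constructor
  · intro h σ
    have hσ := congrArg (fun v : unitGrp (padicVal p) => ((v : (PadicAlgCl p)ˣ) : PadicAlgCl p)) (h ⟨σ, trivial⟩)
    simpa only [unitGrp.coe_smul] using hσ
  · intro h σ
    exact Subtype.ext (Units.ext (by rw [unitGrp.coe_smul]; exact h σ))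

end IUTFork

end Summit.ABC

end
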